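import Literature.Probability.Percolation.ArmSeparationFrame
import HarnessLib

/-!
# The fence of an open crossing, with a general stopping set and the side information

Topic `Literature/Probability/Percolation`; family `crit-perc` / near-critical percolation on `𝕋`.
A brick of the near-critical arm-separation theorem for four arms in the ADJACENT colour
arrangement (P. Nolin, EJP 13 (2008), Thm. 11, `j = 4`, `σ = BBWW` [arXiv 0711.4948: Thm. 10];
the last missing input `hsepAdj` of `Werner2009_lemma63_of_altSeparation_of_adjSeparation`).

`trap_exists_fence` (`ArmSeparationFrame.lean`) follows the frame of a lowest-type open crossing
`c` (tip `z`) inward from the exterior fence site `m` to the FIRST SITE OF `c`, and records only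
that the connection runs in `trapFrameZone M z k ∩ ω`. For two arms of the same colour (Nolin
2008, §4.4, proof of Lemma 15, last paragraph) the walk has to stop at the first site of a larger
set `S ⊇ c` (the crossing together with the arm it serves), and the assembly needs the side
information carried by the invariant of the walk: its sites inside `Λ_{2M}` lie in `above c z`
(hence off `lower c z`, where the other arm's structure lives), its sites outside `Λ_{2M}` lie
strictly above the row of the tip, and none of them is in `S`.

* `trap_exists_fence_gen` — the fence with a stopping set `S` (`↑c ⊆ S ⊆ Λ_{2M}`): an open vertical
  crossing of the corner box through `m`, a site `q ∈ S`, a neighbour `p` of `q`, and an open path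
  from `p` to `m` inside `trapFrameZone M z k ∩ {inside ⇒ above c z} ∩ Sᶜ`.

Everything here is proved (the proof is that of `trap_exists_fence`, with the walk stopped at `S`);
no named facts are introduced.

## References

* P. Nolin, Near-critical percolation in two dimensions, *Electron. J. Probab.* 13 (2008), §4.4,
  proof of Lemma 15 (arXiv 0711.4948: Lemma 14), last paragraph [Nolin2008].
* H. Kesten, Scaling relations for 2D-percolation, *Comm. Math. Phys.* 109 (1987), Lemma 2 (free
  spaces of lowest crossings) [Kesten1987].

Tree: `FrameData`, `nonempty_frameData`, `trap_invariant_step`, `PathIn.inter_of_invariant`,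
`trapFrameZone`, `OpenVCrossThrough`, `PathIn.tri_crossings_meet`, `PathIn.exists_slab_crossing`,
`start_apply_zero_le`, `tip_mem_trapO` (`ArmSeparationFrame.lean`, `ArmSeparationTrapezoid.lean`);
`PathIn.exit`.
-/

noncomputable section

open Set

namespace Literature.Probability.Percolation

open LatticeModels

/-- **The fence of an open crossing, stopped at a set `S ⊇ c`.** Let `c` be a crossing of
`trapDomain M` with tip `z` (it need not even be open here); let `ω'` agree with `ω` off `lower c z` and contain the
open frame at scale `k` about `z` (`1 ≤ k`, `2k + 1 ≤ M`); let `S` be a set of sites of `Λ_{2M}`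
containing `c`. Then in `ω`: the corner box `[z₀+k, z₀+2k] × [z₁+k, z₁+2k]` (outside `Λ_{2M}`) is
crossed vertically by open sites through a site `m`, and `m` is joined to a neighbour `p` of a site
`q ∈ S` by an open path avoiding `S` inside `trapFrameZone M z k`, all of whose sites inside
`Λ_{2M}` lie in `above c z` (and those outside `Λ_{2M}` strictly above the row of `z`). With
`S = c` this is `trap_exists_fence`; with `S = c ∪ (arm)` it attaches the fence to the first of
the two met along the frame. [cite: Nolin2008, §4.4 Lemma 15 (proof) (arXiv 0711.4948: Lemma 14)] [cite: Kesten1987, Lemma 2] -/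
theorem trap_exists_fence_gen {M k : ℕ} {c : Finset (Site 2)} {z : Site 2}
    (hk : 1 ≤ k) (hkM : 2 * (k : ℤ) + 1 ≤ M) (hc : (trapDomain M).IsCrossing c z)
    {ω ω' : SiteConfig (Site 2)}
    (hagree : ∀ v, v ∉ (trapDomain M).lower c z → (v ∈ ω' ↔ v ∈ ω)) (hframe : ω' ∈ triFrameAt z k)
    {S : Set (Site 2)} (hcS : (↑c : Set (Site 2)) ⊆ S) (hSn : ∀ v ∈ S, triNorm v ≤ 2 * M) :
    ∃ m : Site 2, OpenVCrossThrough (triStrip (z 0 + k) (z 1 + k) k k) (z 1 + k) (z 1 + 2 * k) ω m ∧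
      ∃ q ∈ S, ∃ p : Site 2, triGraph.Adj q p ∧
        PathIn triGraph ((trapFrameZone M z k ∩
          {v | (triNorm v ≤ 2 * M → v ∈ (trapDomain M).above c z) ∧ (2 * (M : ℤ) < triNorm v → z 1 < v 1)}) ∩ ω ∩ Sᶜ) p m := by
  have hk' : (1 : ℤ) ≤ k := by exact_mod_cast hk
  have hzO := tip_mem_trapO hc
  have hz' := trapO_coord hzO
  obtain ⟨F⟩ := nonempty_frameData hframe
  -- sites off `lower c z` (in particular sites outside `Λ_{2M}`) carry the same colour in `ω`, `ω'`
  have hlowD : ∀ v ∈ (trapDomain M).lower c z, v ∈ trapD M := fun v hv => JDomain.lower_subset_D hc.subset hv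
  have hext : ∀ v : Site 2, 2 * (M : ℤ) < triNorm v → (v ∈ ω' ↔ v ∈ ω) := by
    intro v hv
    refine hagree v fun h => ?_
    have := (mem_trapD_iff_triNorm.1 (hlowD v h)).2
    omega
  -- the corner box is outside `Λ_{2M}`
  have hEext : ∀ v : Site 2, z 0 + k ≤ v 0 → 2 * (M : ℤ) < triNorm v := by
    intro v hv
    rw [triNorm_eq_max]
    simp only [lt_max_iff]
    omega
  -- the upper part of the right crossing: a vertical crossing `V'` of the corner box
  obtain ⟨e₁, e₂, he₁, he₂, hV⟩ := F.pathE.exists_slab_crossing 1 (L := z 1 + k) (R := z 1 + 2 * k)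
    (by omega) (by rw [F.xE1]; omega) (by rw [F.yE1])
  obtain ⟨SV, hSV, pV, tV⟩ := hV.exists_support
  have hSVb : ∀ v ∈ SV, z 0 + k ≤ v 0 ∧ v 0 ≤ z 0 + 2 * k ∧ z 1 + k ≤ v 1 ∧ v 1 ≤ z 1 + 2 * k := by
    intro v hv
    have h1 := F.boundsE (hSV hv).1
    have h2 := (hSV hv).2
    simp only [Set.mem_setOf_eq] at h2
    omega
  have hSVω : SV ⊆ triStrip (z 0 + k) (z 1 + k) k k ∩ ω := by
    intro v hv
    have hb := hSVb v hv
    refine ⟨?_, (hext v (hEext v hb.1)).1 ((F.SE_sub (hSV hv).1).2)⟩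
    rw [mem_triStrip]; omega
  -- the top crossing meets `V'` at `m`
  obtain ⟨m, hmN, hmV⟩ := PathIn.tri_crossings_meet (L := z 0 - 2 * k) (R := z 0 + 2 * k)
    (B := z 1 + k) (T := z 1 + 2 * k) (fun v hv => by have := F.boundsN hv; omega)
    (fun v hv => by have := hSVb v hv; omega) F.pathN F.xN0 F.yN0 pV he₁ he₂
  refine ⟨m, ⟨e₁, e₂, he₁, he₂, (tV m hmV).mono hSVω, ((tV m hmV).symm.trans pV).mono hSVω⟩, ?_⟩
  -- `c` (hence `S`) meets `Y`
  have hmY : m ∈ F.Y := Or.inl (Or.inl hmN)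
  obtain ⟨f, hfc, hfI⟩ := hc.exists_start
  obtain ⟨y, hyc, hyK⟩ := F.exists_mem_K hk (s := z) (t := f) (by omega)
    (Or.inl (start_apply_zero_le hc hkM hfI)) (hc.conn z hc.tip_mem f hfc)
  have hyc' : y ∈ c := Finset.mem_coe.1 hyc
  have hyY : y ∈ F.Y := by
    rcases hyK with hy | hy
    · exact hy
    · exfalso
      have h1 := (F.boundsE hy).1
      have h2 := (mem_trapD.1 (hc.subset hyc')).2.1
      omega
  -- follow `Y` from `m` to the first site adjacent to `S`
  have hmext : 2 * (M : ℤ) < triNorm m := hEext m (hSVb m hmV).1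
  have hmS : m ∈ Sᶜ := fun h => by have := hSn m h; omega
  obtain ⟨p, q, hpS, hqS, hqY, hpq, hmp⟩ := (F.pathIn_Y hk hmY hyY).exit (R := Sᶜ) hmS (fun h => h (hcS hyc))
  have hqS' : q ∈ S := not_not.1 hqS
  have hmp' : PathIn triGraph ((F.Y \ ↑c) ∩ Sᶜ) m p :=
    hmp.mono fun v hv => ⟨⟨hv.2, fun hvc => hv.1 (hcS hvc)⟩, hv.1⟩
  -- the invariant along this path
  set G : Set (Site 2) := {v | (triNorm v ≤ 2 * M → v ∈ (trapDomain M).above c z) ∧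
      (2 * (M : ℤ) < triNorm v → z 1 < v 1)} with hG
  have hmG : m ∈ G := ⟨fun h => absurd hmext (not_lt.2 h), fun _ => by have := (hSVb m hmV).2.2.1; omega⟩
  have hpath : PathIn triGraph (((F.Y \ ↑c) ∩ Sᶜ) ∩ G) m p :=
    hmp'.inter_of_invariant hmG fun x w hx hxG hw hxw => trap_invariant_step hk hkM hc F hx.1 hw.1 hxw hxG.1 hxG.2
  -- sites satisfying the invariant are open sites of the zone
  have hsub : ((F.Y \ ↑c) ∩ Sᶜ) ∩ G ⊆ (trapFrameZone M z k ∩ G) ∩ ω ∩ Sᶜ := by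
    rintro v ⟨⟨⟨hvY, -⟩, hvS⟩, hvin, hvout⟩
    have hb := F.boundsK (F.Y_subset_K hvY)
    have hvω' : v ∈ ω' := F.K_subset (F.Y_subset_K hvY)
    refine ⟨⟨⟨?_, hvin, hvout⟩, ?_⟩, hvS⟩
    · by_cases hvn : triNorm v ≤ 2 * M
      · have hvT : v ∈ trapD M := mem_trapD_of_triNorm_le (by omega) hvn
        exact ⟨Or.inl hvT, by omega, by omega, by omega, by omega⟩
      · rw [not_le] at hvn
        exact ⟨Or.inr ⟨hvn, hvout hvn⟩, by omega, by omega, by omega, by omega⟩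
    · by_cases hvn : triNorm v ≤ 2 * M
      · have hvT : v ∈ trapD M := mem_trapD_of_triNorm_le (by omega) hvn
        -- `v` is above, hence off `lower c z`, hence unfrozen
        have hva := hvin hvn
        have hvl : v ∉ (trapDomain M).lower c z := fun h =>
          ((JDomain.mem_lower_iff_not_mem_above (show v ∈ (trapDomain M).D from hvT)).1 h) hva
        exact (hagree v hvl).1 hvω'
      · rw [not_le] at hvn
        exact (hext v hvn).1 hvω'
  exact ⟨q, hqS', p, hpq.symm, (hpath.mono hsub).symm⟩

end Literature.Probability.Percolation
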